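import Mathlib.Data.List.Basic
import Mathlib.Data.ENat.Basic
import Mathlib.Analysis.Real.Sqrt
import Mathlib.Order.WithBot
import HarnessLib

-- provenance: harness21/H21/H21/Prelude/CryptoQuantFine/SequenceProblems.lean @ a042e98 (interim HEAD d8f2665); M5 mechanical rewrite
/-!
# Sequence similarity problems: edit distance, LCS, DTW, discrete Fréchet distance

Trunk: CryptoQuantFine (fine-grained complexity), item F1. This file realises the notion
`edit_distance` and the sequence problems (LCS, dynamic time warping, discrete Fréchet distance)
of `fg_core_problems`, as plain recursive functions on lists. They are the objects whose
quadratic-time hardness under SETH is stated in `H21/Statements`.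

## Contents

* `Literature.editDist l₁ l₂ : ℕ` — the Levenshtein (unit-cost insert/delete/substitute) edit distance.
* `Literature.lcsLength l₁ l₂ : ℕ` — the length of a longest common subsequence.
* `Literature.dtwDist l₁ l₂ : ℕ∞` — dynamic time warping distance of integer sequences, cost `|a - b|`.
* `Literature.discreteFrechet P Q : WithTop ℝ` — the discrete Fréchet (coupling) distance of two
  polygonal curves with integer vertices, Euclidean vertex distance.
* Basic API: values on `[]`, the `cons`/`cons` recursion, `editDist_self`, symmetry, triangle
  inequality, the trivial length bounds, `lcsLength_self`, `dtwDist_self`.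

## Sources

* V. I. Levenshtein, *Binary codes capable of correcting deletions, insertions, and reversals*,
  Soviet Physics Doklady 10 (1966).
* R. A. Wagner, M. J. Fischer, *The string-to-string correction problem*, J. ACM 21 (1974), §2
  (the dynamic programme; our recursion is its front-to-back mirror image).
* A. Backurs, P. Indyk, *Edit distance cannot be computed in strongly subquadratic time
  (unless SETH is false)*, STOC 2015, §2.
* K. Bringmann, M. Künnemann, *Quadratic conditional lower bounds for string problems and
  dynamic time warping*, FOCS 2015, §2 (LCS, DTW).
* T. Eiter, H. Mannila, *Computing discrete Fréchet distance*, Tech. report CD-TR 94/64 (1994)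
  (the coupling recursion with `max`/`min`).

## Mathlib

This Mathlib (tag v4.32.0) has no edit distance / Levenshtein distance on lists (searched:
`levenshtein`, `editDist`, `EditDistance` — no hits; there is no `Mathlib/Data/List/EditDistance/`).
Lean core's `Lean.EditDistance` is a `String` utility used for "did you mean" suggestions and has
no API; we do not use it. `ℕ∞`, `WithTop ℝ` (with its linear order) and `Real.sqrt` are Mathlib's.

## Design choices

* All four functions recurse on the *heads* of the lists (the mirror image of the usual
  suffix/prefix table); the values are the same as in print since all four problems are invariant
  under simultaneous reversal.
* Termination is by `xs.length + ys.length`.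
* Junk values (OUTLINE R11). DTW and the discrete Fréchet distance are undefined in print when a
  sequence is empty. We set `dtwDist [] [] = 0`, `discreteFrechet [] [] = 0`, and the value `⊤`
  when exactly one argument is empty. With these conventions the printed recursions
  `D(i,j) = d(i,j) + min (D(i-1,j-1), D(i-1,j), D(i,j-1))` (resp. `max`/`min` for Fréchet) hold
  verbatim for all nonempty prefixes, `⊤` playing the role of the customary `∞` border of the
  table. This is why the codomains are `ℕ∞` and `WithTop ℝ`.
* Points of the Fréchet curves are integer pairs `ℤ × ℤ` (the fine-grained statements are about
  integer/rational inputs on a word RAM); the vertex distance is the real Euclidean distance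
  `Literature.Computability.Cryptography.intEuclideanDist`.
-/

namespace Literature.Computability.Cryptography

variable {α : Type*} [DecidableEq α]

/-! ### Edit distance -/

/-- The **Levenshtein edit distance** between two lists: the minimum number of single-letter
insertions, deletions and substitutions transforming `l₁` into `l₂` (Levenshtein 1966;
Wagner–Fischer 1974, §2). Defined by the standard recursion on the heads:
`editDist [] l = |l|`, `editDist l [] = |l|`, and
`editDist (x :: xs) (y :: ys) = min (editDist xs (y :: ys) + 1) (min (editDist (x :: xs) ys + 1)
  (editDist xs ys + [x ≠ y]))`. [cite: Levenshtein1966] -/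
def editDist : List α → List α → ℕ
  | [], ys => ys.length
  | x :: xs, [] => (x :: xs).length
  | x :: xs, y :: ys =>
      min (editDist xs (y :: ys) + 1)
        (min (editDist (x :: xs) ys + 1) (editDist xs ys + if x = y then 0 else 1))
termination_by xs ys => xs.length + ys.length

/-- Transforming `[]` into `l` takes `|l|` insertions (Wagner–Fischer 1974, §2). [cite: WagnerFischer1974, §2] -/
@[simp]
theorem editDist_nil_left (l : List α) : editDist [] l = l.length := by
  simp [editDist]

/-- Transforming `l` into `[]` takes `|l|` deletions (Wagner–Fischer 1974, §2). [cite: WagnerFischer1974, §2] -/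
@[simp]
theorem editDist_nil_right (l : List α) : editDist l [] = l.length := by
  cases l <;> simp [editDist]

/-- The defining recursion of `editDist` on two nonempty lists (Wagner–Fischer 1974, eq. (2)). [cite: WagnerFischer1974, eq. (2] -/
theorem editDist_cons_cons (x y : α) (xs ys : List α) :
    editDist (x :: xs) (y :: ys) =
      min (editDist xs (y :: ys) + 1)
        (min (editDist (x :: xs) ys + 1) (editDist xs ys + if x = y then 0 else 1)) := by
  simp [editDist]

/-- The edit distance from a list to itself is `0` (Wagner–Fischer 1974, Property 1). [cite: WagnerFischer1974, Property 1] -/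
@[simp]
theorem editDist_self (l : List α) : editDist l l = 0 := by
  induction l with
  | nil => simp
  | cons x xs ih => simp [editDist_cons_cons, ih]

/-- The edit distance is symmetric (unit costs; Wagner–Fischer 1974, §2). [cite: WagnerFischer1974, §2] -/
def editDist_comm : Prop :=
  ∀ (l₁ l₂ : List α),
    editDist l₁ l₂ = editDist l₂ l₁

/-- The edit distance satisfies the triangle inequality (Wagner–Fischer 1974, §2: traces
compose). [cite: WagnerFischer1974, §2: traces compose] -/
def editDist_triangle : Prop :=
  ∀ (l₁ l₂ l₃ : List α),
    editDist l₁ l₃ ≤ editDist l₁ l₂ + editDist l₂ l₃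

/-- Trivial upper bound: substitute the common prefix length and insert/delete the rest, so
`editDist l₁ l₂ ≤ max |l₁| |l₂|` (Backurs–Indyk 2015, §2). [cite: BackursIndyk2015, §2] -/
theorem editDist_le_max_length (l₁ l₂ : List α) :
    editDist l₁ l₂ ≤ max l₁.length l₂.length := by
  induction l₁, l₂ using editDist.induct with
  | case1 l => simp
  | case2 x xs => simp
  | case3 x xs y ys ih1 ih2 ih3 =>
      simp only [editDist_cons_cons, List.length_cons] at *; split_ifs <;> omega

/-- The edit distance vanishes exactly on equal lists (Wagner–Fischer 1974, §2). [cite: WagnerFischer1974, §2] -/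
def editDist_eq_zero_iff : Prop :=
  ∀ (l₁ l₂ : List α),
    editDist l₁ l₂ = 0 ↔ l₁ = l₂

/-! ### Longest common subsequence -/

/-- The **length of a longest common subsequence** of two lists (Wagner–Fischer 1974, §5;
Bringmann–Künnemann 2015, §2): `lcsLength [] l = lcsLength l [] = 0` and
`lcsLength (x :: xs) (y :: ys) = if x = y then lcsLength xs ys + 1
  else max (lcsLength xs (y :: ys)) (lcsLength (x :: xs) ys)`. [cite: WagnerFischer1974, §5] -/
def lcsLength : List α → List α → ℕ
  | [], _ => 0
  | _ :: _, [] => 0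
  | x :: xs, y :: ys =>
      if x = y then lcsLength xs ys + 1 else max (lcsLength xs (y :: ys)) (lcsLength (x :: xs) ys)
termination_by xs ys => xs.length + ys.length

/-- The empty list has only the empty common subsequence (Wagner–Fischer 1974, §5). [cite: WagnerFischer1974, §5] -/
@[simp]
theorem lcsLength_nil_left (l : List α) : lcsLength [] l = 0 := by
  simp [lcsLength]

/-- The empty list has only the empty common subsequence (Wagner–Fischer 1974, §5). [cite: WagnerFischer1974, §5] -/
@[simp]
theorem lcsLength_nil_right (l : List α) : lcsLength l [] = 0 := by
  cases l <;> simp [lcsLength]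

/-- The defining recursion of `lcsLength` on two nonempty lists
(Bringmann–Künnemann 2015, §2). [cite: BringmannKunnemann2015, §2] -/
theorem lcsLength_cons_cons (x y : α) (xs ys : List α) :
    lcsLength (x :: xs) (y :: ys) =
      if x = y then lcsLength xs ys + 1
      else max (lcsLength xs (y :: ys)) (lcsLength (x :: xs) ys) := by
  simp [lcsLength]

/-- A common subsequence is no longer than either list (Wagner–Fischer 1974, §5). [cite: WagnerFischer1974, §5] -/
theorem lcsLength_le_min_length (l₁ l₂ : List α) :
    lcsLength l₁ l₂ ≤ min l₁.length l₂.length := by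
  induction l₁, l₂ using lcsLength.induct with
  | case1 l => simp
  | case2 x xs => simp
  | case3 x xs ys ih => simp only [lcsLength_cons_cons, List.length_cons, if_true] at *; omega
  | case4 x xs y ys hne ih1 ih2 =>
      simp only [lcsLength_cons_cons, hne, List.length_cons, if_false] at *; omega

/-- A common subsequence is no longer than the first list (Wagner–Fischer 1974, §5). [cite: WagnerFischer1974, §5] -/
theorem lcsLength_le_length_left (l₁ l₂ : List α) : lcsLength l₁ l₂ ≤ l₁.length :=
  (lcsLength_le_min_length l₁ l₂).trans (min_le_left _ _)

/-- A common subsequence is no longer than the second list (Wagner–Fischer 1974, §5). [cite: WagnerFischer1974, §5] -/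
theorem lcsLength_le_length_right (l₁ l₂ : List α) : lcsLength l₁ l₂ ≤ l₂.length :=
  (lcsLength_le_min_length l₁ l₂).trans (min_le_right _ _)

/-- A list is a longest common subsequence of itself with itself
(Wagner–Fischer 1974, §5). [cite: WagnerFischer1974, §5] -/
@[simp]
theorem lcsLength_self (l : List α) : lcsLength l l = l.length := by
  induction l with
  | nil => simp
  | cons x xs ih => simp [lcsLength_cons_cons, ih]

/-! ### Dynamic time warping -/

/-- The **dynamic time warping distance** of two integer sequences with local cost `|a - b|`
(Bringmann–Künnemann 2015, §2): the minimum, over all monotone traversals (couplings) of the two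
sequences, of the sum of the costs of the coupled pairs. Recursion on the heads:
`dtwDist (x :: xs) (y :: ys) = |x - y| + min (dtwDist xs ys) (min (dtwDist xs (y :: ys))
  (dtwDist (x :: xs) ys))`.

**Junk values** (undefined in print, OUTLINE R11): `dtwDist [] [] = 0` and `dtwDist [] l =
dtwDist l [] = ⊤` for nonempty `l`; these are exactly the `0`/`∞` border entries of the usual
dynamic-programming table, whence the codomain `ℕ∞`. On two nonempty lists the value is finite. [cite: BringmannKunnemann2015, §2] -/
def dtwDist : List ℤ → List ℤ → ℕ∞
  | [], [] => 0
  | [], _ :: _ => ⊤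
  | _ :: _, [] => ⊤
  | x :: xs, y :: ys =>
      ((x - y).natAbs : ℕ∞) + min (dtwDist xs ys) (min (dtwDist xs (y :: ys)) (dtwDist (x :: xs) ys))
termination_by xs ys => xs.length + ys.length

/-- Junk value: `dtwDist [] [] = 0` (OUTLINE R11). Not `@[simp]`: subsumed by
`dtwDist_self`. [folklore] -/
theorem dtwDist_nil_nil : dtwDist [] [] = 0 := by
  simp [dtwDist]

/-- Junk value: `dtwDist [] l = ⊤` for nonempty `l` (OUTLINE R11). [folklore] -/
@[simp]
theorem dtwDist_nil_cons (y : ℤ) (ys : List ℤ) : dtwDist [] (y :: ys) = ⊤ := by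
  simp [dtwDist]

/-- Junk value: `dtwDist l [] = ⊤` for nonempty `l` (OUTLINE R11). [folklore] -/
@[simp]
theorem dtwDist_cons_nil (x : ℤ) (xs : List ℤ) : dtwDist (x :: xs) [] = ⊤ := by
  simp [dtwDist]

/-- The defining recursion of `dtwDist` on two nonempty sequences
(Bringmann–Künnemann 2015, §2). [cite: BringmannKunnemann2015, §2] -/
theorem dtwDist_cons_cons (x y : ℤ) (xs ys : List ℤ) :
    dtwDist (x :: xs) (y :: ys) =
      ((x - y).natAbs : ℕ∞) +
        min (dtwDist xs ys) (min (dtwDist xs (y :: ys)) (dtwDist (x :: xs) ys)) := by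
  simp [dtwDist]

/-- The dynamic time warping distance of a sequence to itself is `0` (couple diagonally;
Bringmann–Künnemann 2015, §2). [cite: BringmannKunnemann2015, §2] -/
@[simp]
theorem dtwDist_self (l : List ℤ) : dtwDist l l = 0 := by
  induction l with
  | nil => exact dtwDist_nil_nil
  | cons x xs ih => simp [dtwDist_cons_cons, ih]

/-! ### Discrete Fréchet distance -/

/-- The Euclidean distance between two integer points of the plane, as a real number:
`√((p₁ - q₁)² + (p₂ - q₂)²)` (Eiter–Mannila 1994, §1, the metric `d`). [cite: EiterMannila1994, §1  the metric  d] -/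
noncomputable def intEuclideanDist (p q : ℤ × ℤ) : ℝ :=
  Real.sqrt (((p.1 - q.1) ^ 2 + (p.2 - q.2) ^ 2 : ℤ) : ℝ)

/-- The Euclidean distance of a point to itself is `0`. [folklore] -/
@[simp]
theorem intEuclideanDist_self (p : ℤ × ℤ) : intEuclideanDist p p = 0 := by
  simp [intEuclideanDist]

/-- The Euclidean distance is nonnegative. [folklore] -/
theorem intEuclideanDist_nonneg (p q : ℤ × ℤ) : 0 ≤ intEuclideanDist p q :=
  Real.sqrt_nonneg _

/-- The **discrete Fréchet distance** (coupling distance) of two polygonal curves given by their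
vertex lists `P Q : List (ℤ × ℤ)` (Eiter–Mannila 1994, Definition 1 and the recursion of
Function `dF`, §3): the minimum over all couplings of the maximum Euclidean distance of a coupled
pair. Recursion on the heads:
`discreteFrechet (p :: ps) (q :: qs) = max (d p q) (min (discreteFrechet ps qs)
  (min (discreteFrechet ps (q :: qs)) (discreteFrechet (p :: ps) qs)))`.

**Junk values** (undefined in print, OUTLINE R11): `discreteFrechet [] [] = 0` and
`discreteFrechet [] Q = discreteFrechet P [] = ⊤` for nonempty `P`, `Q`; these are the `−`/`∞`
border entries of the Eiter–Mannila table, whence the codomain `WithTop ℝ`. On two nonempty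
curves the value is a (nonnegative) real. [cite: EiterMannila1994, Definition 1 and the recursion of Functi] -/
noncomputable def discreteFrechet : List (ℤ × ℤ) → List (ℤ × ℤ) → WithTop ℝ
  | [], [] => 0
  | [], _ :: _ => ⊤
  | _ :: _, [] => ⊤
  | p :: ps, q :: qs =>
      max (intEuclideanDist p q : WithTop ℝ)
        (min (discreteFrechet ps qs)
          (min (discreteFrechet ps (q :: qs)) (discreteFrechet (p :: ps) qs)))
termination_by ps qs => ps.length + qs.length

/-- Junk value: `discreteFrechet [] [] = 0` (OUTLINE R11). Not `@[simp]`: subsumed by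
`discreteFrechet_self`. [folklore] -/
theorem discreteFrechet_nil_nil : discreteFrechet [] [] = 0 := by
  simp [discreteFrechet]

/-- Junk value: `discreteFrechet [] Q = ⊤` for nonempty `Q` (OUTLINE R11). [folklore] -/
@[simp]
theorem discreteFrechet_nil_cons (q : ℤ × ℤ) (qs : List (ℤ × ℤ)) :
    discreteFrechet [] (q :: qs) = ⊤ := by
  simp [discreteFrechet]

/-- Junk value: `discreteFrechet P [] = ⊤` for nonempty `P` (OUTLINE R11). [folklore] -/
@[simp]
theorem discreteFrechet_cons_nil (p : ℤ × ℤ) (ps : List (ℤ × ℤ)) :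
    discreteFrechet (p :: ps) [] = ⊤ := by
  simp [discreteFrechet]

/-- The Eiter–Mannila coupling recursion on two nonempty curves (Eiter–Mannila 1994, §3). [cite: EiterMannila1994, §3] -/
theorem discreteFrechet_cons_cons (p q : ℤ × ℤ) (ps qs : List (ℤ × ℤ)) :
    discreteFrechet (p :: ps) (q :: qs) =
      max (intEuclideanDist p q : WithTop ℝ)
        (min (discreteFrechet ps qs)
          (min (discreteFrechet ps (q :: qs)) (discreteFrechet (p :: ps) qs))) := by
  simp [discreteFrechet]

/-- Two one-vertex curves are at discrete Fréchet distance the distance of their vertices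
(Eiter–Mannila 1994, §3, base case of `dF`); in particular the junk border values do not leak. [cite: EiterMannila1994, §3  base case of  dF] -/
theorem discreteFrechet_singleton_singleton (p q : ℤ × ℤ) :
    discreteFrechet [p] [q] = (intEuclideanDist p q : WithTop ℝ) := by
  rw [discreteFrechet_cons_cons]
  simp only [discreteFrechet_nil_nil, discreteFrechet_nil_cons, discreteFrechet_cons_nil,
    min_self, le_top, min_eq_left, max_eq_left_iff]
  exact_mod_cast intEuclideanDist_nonneg p q

/-- The discrete Fréchet distance of a curve to itself is `0` (couple diagonally;
Eiter–Mannila 1994, §2). [cite: EiterMannila1994, §2] -/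
@[simp]
theorem discreteFrechet_self (P : List (ℤ × ℤ)) : discreteFrechet P P = 0 := by
  induction P with
  | nil => exact discreteFrechet_nil_nil
  | cons p ps ih =>
      rw [discreteFrechet_cons_cons, ih, intEuclideanDist_self]
      simp

end Literature.Computability.Cryptography
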